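import Summits.CriticalPhenomena.PercolationContinuityZ3.Theorems.Transplant.FKConnectivityAllQAntipodalLevel4
import HarnessLib

/-!
# Connectivity correlation inequalities for `φ_{w,q}`, every `q > 0` — file 38a: FOLD LEMMAS (abstract additivity of the antipodal
# exponent, composition of folds)

Support file (`--supports stmt-CriticalPhenomena-4575`), FK sub-lane `prim-bschramm-fk-2` (gen 20); builds on p205010 (kernel theorem,
internal audit signed; external expert review pending).  No definitions, no named facts, no sorries; standard axioms.

Bookkeeping for file 38b (`FK.prune`): `FK.apPsi_smul_right`; `FK.fold_empty` (the fold over `∅` is multiplication by `q^{2|V|}`);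
`FK.fold_fold` (folding `Pa` then `Pb` = `q^{2|V|}` × folding `Pa ∪ Pb`, given additivity of the antipodal exponents);
`FK.apPsi_fold_eq_of_add` (THE FOLD under an abstract additivity `apExp (M₁∪M₂)(γ₁∪γ₂) + 2|V| = apExp M₁ γ₁ + apExp M₂ γ₂`:
`q^{2|V|}·apPsi q (M₁∪M₂) f g = apPsi q M₁ f ĝ`, `ĝ β = Σ_{γ₂⊆M₂} q^{k(γ₂)+k(M₂∖γ₂)} g(β∪γ₂)`, for `f` not reading `M₂`; file 36's
`FK.apPsi_oneSum_eq` is the one-vertex instance); the two additivity suppliers `FK.apExp_add_oneSum` (supports meeting in ≤ 1 vertex,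
`FK.apExp_series`) and `FK.apExp_add_twoPoint` (supports meeting inside `{a,b}`, no `a–b` path in the second part: the junction indicators
of `FK.apExp_parallel` vanish).
[cite: Grimmett2006, §1.4 eq. (1.20) (p. 15); §3.8 Thm. (3.90) (pp. 61–62)]
-/

noncomputable section

namespace Summit.CriticalPhenomena.PercolationContinuityZ3.Theorems

namespace FK

open Literature.Probability.LatticeModels Literature.Probability.Percolation
open scoped Classical

variable {V : Type*} [Fintype V]

/-! ### Folds under an abstract additivity of the antipodal exponent -/

section Fold

omit [Fintype V] in
/-- `apPsi` is homogeneous in the second test function. [folklore] -/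
theorem apPsi_smul_right (q : ℝ) (H : Finset (Sym2 V)) (f G : Finset (Sym2 V) → ℝ) (c : ℝ) :
    apPsi q H f (fun A => c * G A) = c * apPsi q H f G := by
  unfold apPsi
  rw [Finset.mul_sum]
  exact Finset.sum_congr rfl fun γ _ => by ring

/-- The fold over the empty set is multiplication by `q^{2|V|}` (`k(∅) = |V|`). [folklore] -/
theorem fold_empty (q : ℝ) (G : Finset (Sym2 V) → ℝ) :
    (fun β : Finset (Sym2 V) => ∑ δ ∈ (∅ : Finset (Sym2 V)).powerset, q ^ apExp ∅ δ * G (β ∪ δ)) =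
      fun β => q ^ (2 * Fintype.card V) * G β := by
  funext β
  rw [Finset.powerset_empty, Finset.sum_singleton, Finset.union_empty]
  unfold apExp
  rw [Finset.sdiff_empty, Finset.coe_empty, clusterCount_empty_card, two_mul]

/-- **Composition of folds**: folding `Pa` and then `Pb` (disjoint, antipodal exponents adding up to that of `Pa ∪ Pb` plus `2|V|`) is
`q^{2|V|}` times the fold over `Pa ∪ Pb`. [folklore] -/
theorem fold_fold (q : ℝ) {Pa Pb : Finset (Sym2 V)} (hd : Disjoint Pa Pb)
    (hadd : ∀ δa : Finset (Sym2 V), δa ⊆ Pa → ∀ δb : Finset (Sym2 V), δb ⊆ Pb →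
      apExp (Pa ∪ Pb) (δa ∪ δb) + 2 * Fintype.card V = apExp Pa δa + apExp Pb δb) (G : Finset (Sym2 V) → ℝ) :
    (fun β : Finset (Sym2 V) => ∑ δb ∈ Pb.powerset, q ^ apExp Pb δb *
        ∑ δa ∈ Pa.powerset, q ^ apExp Pa δa * G (β ∪ δb ∪ δa)) =
      fun β => q ^ (2 * Fintype.card V) * ∑ δ ∈ (Pa ∪ Pb).powerset, q ^ apExp (Pa ∪ Pb) δ * G (β ∪ δ) := by
  funext β
  rw [Finset.mul_sum, sum_powerset_union_disj hd, Finset.sum_comm]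
  refine Finset.sum_congr rfl fun δb hδb => ?_
  rw [Finset.mul_sum]
  refine Finset.sum_congr rfl fun δa hδa => ?_
  have h := hadd δa (Finset.mem_powerset.1 hδa) δb (Finset.mem_powerset.1 hδb)
  have hpow : q ^ apExp Pb δb * q ^ apExp Pa δa = q ^ (2 * Fintype.card V) * q ^ apExp (Pa ∪ Pb) (δa ∪ δb) := by
    rw [← pow_add, ← pow_add, add_comm (2 * Fintype.card V), h, add_comm]
  rw [show β ∪ δb ∪ δa = β ∪ (δa ∪ δb) by
    rw [Finset.union_assoc, Finset.union_comm δb δa]]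
  calc q ^ apExp Pb δb * (q ^ apExp Pa δa * G (β ∪ (δa ∪ δb)))
      = (q ^ apExp Pb δb * q ^ apExp Pa δa) * G (β ∪ (δa ∪ δb)) := by ring
    _ = q ^ (2 * Fintype.card V) * (q ^ apExp (Pa ∪ Pb) (δa ∪ δb) * G (β ∪ (δa ∪ δb))) := by rw [hpow]; ring

/-- **The fold under an abstract additivity** of the antipodal exponent: `M₁, M₂` disjoint with
`apExp (M₁∪M₂) (γ₁∪γ₂) + 2|V| = apExp M₁ γ₁ + apExp M₂ γ₂`, `f` not reading `M₂` ⟹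
`q^{2|V|} · apPsi q (M₁ ∪ M₂) f g = apPsi q M₁ f ĝ`, `ĝ(β) = Σ_{γ₂ ⊆ M₂} q^{k(γ₂)+k(M₂∖γ₂)} g(β ∪ γ₂)`. [cite: Grimmett2006, §3.8 (pp. 61–62)] -/
theorem apPsi_fold_eq_of_add (q : ℝ) {M₁ M₂ : Finset (Sym2 V)} (hdM : Disjoint M₁ M₂)
    (hadd : ∀ γ₁ : Finset (Sym2 V), γ₁ ⊆ M₁ → ∀ γ₂ : Finset (Sym2 V), γ₂ ⊆ M₂ →
      apExp (M₁ ∪ M₂) (γ₁ ∪ γ₂) + 2 * Fintype.card V = apExp M₁ γ₁ + apExp M₂ γ₂)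
    {f : Finset (Sym2 V) → ℝ} (hf : ∀ X Y : Finset (Sym2 V), Y ⊆ M₂ → f (X ∪ Y) = f X) (g : Finset (Sym2 V) → ℝ) :
    q ^ (2 * Fintype.card V) * apPsi q (M₁ ∪ M₂) f g =
      apPsi q M₁ f (fun β => ∑ γ₂ ∈ M₂.powerset, q ^ apExp M₂ γ₂ * g (β ∪ γ₂)) := by
  unfold apPsi
  rw [Finset.mul_sum, sum_powerset_union_disj hdM]
  refine Finset.sum_congr rfl fun γ₁ hγ₁ => ?_
  rw [Finset.mem_powerset] at hγ₁
  have hflip : (∑ γ₂ ∈ M₂.powerset, q ^ apExp M₂ γ₂ * g (M₁ \ γ₁ ∪ γ₂)) =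
      ∑ γ₂ ∈ M₂.powerset, q ^ apExp M₂ γ₂ * g (M₁ \ γ₁ ∪ M₂ \ γ₂) := by
    rw [sum_powerset_flip M₂ (fun γ₂ => q ^ apExp M₂ γ₂ * g (M₁ \ γ₁ ∪ γ₂))]
    exact Finset.sum_congr rfl fun γ₂ hγ₂ => by rw [apExp_compl (Finset.mem_powerset.1 hγ₂)]
  dsimp only
  rw [hflip, ← Finset.sum_sub_distrib, Finset.mul_sum, Finset.mul_sum]
  refine Finset.sum_congr rfl fun γ₂ hγ₂ => ?_
  rw [Finset.mem_powerset] at hγ₂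
  have hexp := hadd γ₁ hγ₁ γ₂ hγ₂
  have hpow : q ^ (2 * Fintype.card V) * q ^ apExp (M₁ ∪ M₂) (γ₁ ∪ γ₂) = q ^ apExp M₁ γ₁ * q ^ apExp M₂ γ₂ := by
    rw [← pow_add, ← pow_add, add_comm (2 * Fintype.card V), hexp]
  rw [union_sdiff_union hdM hγ₁ hγ₂, hf γ₁ γ₂ hγ₂, hf (M₁ \ γ₁) (M₂ \ γ₂) Finset.sdiff_subset, ← mul_sub]
  calc q ^ (2 * Fintype.card V) * (q ^ apExp (M₁ ∪ M₂) (γ₁ ∪ γ₂) *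
          ((f γ₁ - f (M₁ \ γ₁)) * (g (γ₁ ∪ γ₂) - g (M₁ \ γ₁ ∪ M₂ \ γ₂))))
      = (q ^ (2 * Fintype.card V) * q ^ apExp (M₁ ∪ M₂) (γ₁ ∪ γ₂)) *
          ((f γ₁ - f (M₁ \ γ₁)) * (g (γ₁ ∪ γ₂) - g (M₁ \ γ₁ ∪ M₂ \ γ₂))) := by ring
    _ = q ^ apExp M₁ γ₁ * ((f γ₁ - f (M₁ \ γ₁)) * (q ^ apExp M₂ γ₂ * (g (γ₁ ∪ γ₂) - g (M₁ \ γ₁ ∪ M₂ \ γ₂)))) := by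
      rw [hpow]; ring

variable {E₁ E₂ : Finset (Sym2 V)} {V₁ V₂ : Set V} {a b m : V}

/-- Additivity of the antipodal exponent over a one-vertex gluing (`FK.apExp_series`, restated for sub-parts). [cite: Grimmett2006, §3.8 (pp. 61–62)] -/
theorem apExp_add_oneSum (hd : Disjoint E₁ E₂) (h₁ : ∀ e ∈ (↑E₁ : Set (Sym2 V)), ∀ z ∈ e, z ∈ V₁)
    (h₂ : ∀ e ∈ (↑E₂ : Set (Sym2 V)), ∀ z ∈ e, z ∈ V₂) (hS : V₁ ∩ V₂ ⊆ {m}) {M₁ M₂ : Finset (Sym2 V)} (hM₁ : M₁ ⊆ E₁)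
    (hM₂ : M₂ ⊆ E₂) : ∀ γ₁ : Finset (Sym2 V), γ₁ ⊆ M₁ → ∀ γ₂ : Finset (Sym2 V), γ₂ ⊆ M₂ →
      apExp (M₁ ∪ M₂) (γ₁ ∪ γ₂) + 2 * Fintype.card V = apExp M₁ γ₁ + apExp M₂ γ₂ :=
  fun _ hγ₁ _ hγ₂ => apExp_series hd h₁ h₂ hS hM₁ hM₂ hγ₁ hγ₂

/-- **Additivity over a two-vertex gluing without a path**: if the parts' supports meet inside `{a, b}` (`a ≠ b`) and the second part has no
`a–b` path, the junction indicators of `FK.apExp_parallel` vanish. [cite: Grimmett2006, §3.8 (pp. 61–62)] -/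
theorem apExp_add_twoPoint (hd : Disjoint E₁ E₂) (h₁ : ∀ e ∈ (↑E₁ : Set (Sym2 V)), ∀ z ∈ e, z ∈ V₁)
    (h₂ : ∀ e ∈ (↑E₂ : Set (Sym2 V)), ∀ z ∈ e, z ∈ V₂) (hS : V₁ ∩ V₂ ⊆ {a, b}) (hab : a ≠ b) {M₁ M₂ : Finset (Sym2 V)}
    (hM₁ : M₁ ⊆ E₁) (hM₂ : M₂ ⊆ E₂) (hnr : ¬ (openGraph (↑M₂ : BondConfig V)).Reachable a b) :
    ∀ γ₁ : Finset (Sym2 V), γ₁ ⊆ M₁ → ∀ γ₂ : Finset (Sym2 V), γ₂ ⊆ M₂ →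
      apExp (M₁ ∪ M₂) (γ₁ ∪ γ₂) + 2 * Fintype.card V = apExp M₁ γ₁ + apExp M₂ γ₂ := by
  intro γ₁ hγ₁ γ₂ hγ₂
  have nr1 : ¬ (openGraph (↑γ₂ : BondConfig V)).Reachable a b :=
    fun h => hnr (h.mono (SimpleGraph.fromEdgeSet_mono (Finset.coe_subset.2 hγ₂)))
  have nr2 : ¬ (openGraph (↑(M₂ \ γ₂) : BondConfig V)).Reachable a b :=
    fun h => hnr (h.mono (SimpleGraph.fromEdgeSet_mono (Finset.coe_subset.2 Finset.sdiff_subset)))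
  have key := apExp_parallel hd h₁ h₂ hS hab hM₁ hM₂ hγ₁ hγ₂
  simp only [nr1, nr2, and_false, if_false, add_zero] at key
  exact key

end Fold

end FK

end Summit.CriticalPhenomena.PercolationContinuityZ3.Theorems

end
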